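import Mathlib
import HarnessLib

/-!
# Route `GenusKolyvaginAtTwo`, LINE 6, KEY crux Q3 `EquivariantKolyvaginExactAtTwo`
# (stmt-BirchSwinnertonDyer-24882): McCallum's "orders multiply" principle as pure COUNTING —
# the abstract heart of the `duality` field over `ℚ_ℓ` at `2`, with no cyclicity, no eigenvectors, no (7.6)

Helper (seat `bsd-line-gk2-p3` g11; `--supports` the item, closes nothing). Sequel to `…ReciprocityRat`,
where the `duality` field of the split descent over `ℚ_ℓ` was landed modulo a local shape à la Gross
(7.6) for a regular Frobenius action. OBSERVATION recorded and proved here in abstract form: McCallum's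
Lemma 5.3 (*"the Tate pairing induces … a duality of cyclic groups of order `p^M` … orders multiply to
more than `p^M`"*) needs, over `ℚ_ℓ`, neither the explicit tame formula (7.6) nor cyclicity — only that
the local condition `U = 𝓛_v ≤ H = H¹(ℚ_ℓ, E[2^M])` is its own annihilator (`U^⊥ ⊆ U`, Tate local
duality for `E` off `2`: the tree's `…LocalDualityPerfect`) and has EXACTLY `p^M` elements (this lineage's
`…LocalDualityOrder.natCard_kummerLocalConditionAt_two_pow_eq` at a Gross–Kolyvagin prime of index
`≥ M` on `Δ < 0` — where "type T, depth `M`" enters; at a prime of the wrong type `#𝓛_v > 2^M` and the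
bound degrades by the excess, the known `2`-adic defect).

* `pow_smul_eq_zero_of_character_of_card` — **for `U ≤ H` of order `p^M`, a character `ψ : H →+ C`
  (= `B(z, ·)` for a fixed class `z`) with `ψ x = 0`, `x ∈ U`, and `p^a·ψ` NOT vanishing on `U`
  (for `B`: `p^a z ∉ U = U^⊥`): `p^{M−1−a}·x = 0`.** The image of `ψ|_U` has order `p^b ≥ p^{a+1}`, so
  its kernel has order `p^{M−b} ≤ p^{M−1−a}` and contains `x`.

INSTANTIATION RECIPE (not carried out here — the remaining work is carrier/instance plumbing between the
tree's `galH1Torsion`/`galoisCohomology`/`continuousCohomology` types at `K = ℚ`, see the seat's notes):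
`H = H¹(ℚ_v, E[2^M])`, `U = kummerLocalConditionAt`, `ψ = (d_v ∪ₑ ·)` (Weil cup product, a `LinearMap`),
`x = s_v` for `s` Selmer at `v` (`mem_kummerLocalConditionAt_res_of_mem_selmerLocalKer`), `hnot` from
`2^a d` not Selmer at `v` and `U^⊥ ⊆ U` (`forall_mem_kummerLocalConditionAt_weilCupProduct_eq_zero_iff_of_not_mem`),
`ψ x = 0` from Poitou–Tate (`…ReciprocityRat.cupProduct_localization_eq_zero_of_selmer`), and the
conclusion `2^{M−1−a} s_v = 0` read back through `mem_torsionLocalKer_iff_res_eq_zero` — this would make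
the `duality` field of `KolyvaginDescent.SplitHypothesesM` over `ℚ_ℓ` at `2` UNCONDITIONAL.

THEOREMS ONLY (no definition, no named fact, no `sorry`, standard axioms). BSD is not proved by any of this.

References: [McCallumLMS1991] §2 Prop. 2.2, §5 Lemma 5.3 and proof of Thm. 5.4; [MilneADT2006] I Cor. 3.4.
-/

set_option autoImplicit false
set_option linter.dupNamespace false -- tree convention: `Summit.BirchSwinnertonDyer.BirchSwinnertonDyer.Theorems` (summit = sub-problem)

noncomputable section

open scoped Classical

namespace Summit.BirchSwinnertonDyer.BirchSwinnertonDyer.Theorems.GenusExact.FrobeniusCriterion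

/-! ## §1 The counting lemma: orders multiply to at most `#U` across a self-annihilating subgroup -/

section Counting

variable {H C : Type*} [AddCommGroup H] [AddCommGroup C]

/-- **McCallum's "orders multiply" principle, abstract form.** Let `U ≤ H` be a subgroup of order `p^M`
(`p` prime) and `ψ : H →+ C` a character (the pairing `B(z, ·)` against a fixed class `z`) with
`ψ x = 0` for some `x ∈ U`, such that `p^a·ψ` does NOT vanish on `U` (for `B`: `p^a z ∉ U = U^⊥`). Then
**`p^{M−1−a}·x = 0`**: the image of `ψ|_U` has order `p^b ≥ p^{a+1}`, so its kernel has order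
`p^{M−b} ≤ p^{M−1−a}` and contains `x`. [cite: McCallumLMS1991, §5 Lemma 5.3 and proof of Thm. 5.4 ("orders multiply to more than p^M")] -/
theorem pow_smul_eq_zero_of_character_of_card {p : ℕ} (hp : p.Prime) {M : ℕ}
    {U : AddSubgroup H} (hU : Nat.card U = p ^ M) (ψ : H →+ C)
    {a : ℕ} (hnot : ¬ ∀ y ∈ U, (p ^ a) • ψ y = 0) {x : H} (hx : x ∈ U) (hψx : ψ x = 0) :
    (p ^ (M - 1 - a)) • x = 0 := by
  haveI : Fact p.Prime := ⟨hp⟩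
  haveI : Finite U := Nat.finite_of_card_ne_zero (by rw [hU]; exact pow_ne_zero M hp.ne_zero)
  set ψU : U →+ C := ψ.comp U.subtype with hψU
  have hψapp : ∀ y : U, ψU y = ψ y := fun _ ↦ rfl
  -- some `y₀ ∈ U` with `p^a ψ y₀ ≠ 0`
  obtain ⟨y₀, hy₀U, hy₀⟩ : ∃ y₀ ∈ U, (p ^ a) • ψ y₀ ≠ 0 := by
    by_contra h
    push Not at h
    exact hnot h
  have hy₀' : (p ^ a) • ψU ⟨y₀, hy₀U⟩ ≠ 0 := by rwa [hψapp]
  -- `#range ψU = p^b` with `b ≥ a + 1`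
  have hdiv : Nat.card ψU.range ∣ p ^ M := by
    rw [← hU]
    exact AddSubgroup.card_dvd_of_surjective ψU.rangeRestrict ψU.rangeRestrict_surjective
  obtain ⟨b, -, hb⟩ := (Nat.dvd_prime_pow hp).mp hdiv
  have hab : a + 1 ≤ b := by
    by_contra hlt
    push Not at hlt
    apply hy₀'
    have hkill : (p ^ b) • ψU ⟨y₀, hy₀U⟩ = 0 := by
      have h := card_nsmul_eq_zero' (G := ψU.range) (x := ⟨ψU ⟨y₀, hy₀U⟩, ⟨_, rfl⟩⟩)
      rw [hb] at h
      exact congrArg Subtype.val h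
    obtain ⟨c, hc⟩ : ∃ c, a = b + c := ⟨a - b, by omega⟩
    rw [hc, pow_add, mul_nsmul, hkill, nsmul_zero]
  -- `#ker ψU = p^c` with `b + c = M`
  have hprod : Nat.card ψU.range * Nat.card ψU.ker = p ^ M := by
    rw [← hU, AddSubgroup.card_eq_card_quotient_mul_card_addSubgroup ψU.ker,
      Nat.card_congr (QuotientAddGroup.quotientKerEquivRange ψU).toEquiv]
  have hkerdvd : Nat.card ψU.ker ∣ p ^ M := Dvd.intro_left _ hprod
  obtain ⟨c, -, hc⟩ := (Nat.dvd_prime_pow hp).mp hkerdvd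
  have hbc : b + c = M := by
    apply Nat.pow_right_injective hp.two_le
    change p ^ (b + c) = p ^ M
    rw [pow_add, ← hb, ← hc, hprod]
  -- `x ∈ ker ψU` is killed by `#ker ψU = p^c`, and `M - 1 - a ≥ c`
  have hxker : (⟨x, hx⟩ : U) ∈ ψU.ker := by
    rw [AddMonoidHom.mem_ker, hψapp]
    exact hψx
  have hkill : (p ^ c) • x = 0 := by
    have h := card_nsmul_eq_zero' (G := ψU.ker) (x := ⟨⟨x, hx⟩, hxker⟩)
    rw [hc] at h
    exact congrArg (fun t : ψU.ker ↦ ((t : U) : H)) h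
  obtain ⟨d, hd⟩ : ∃ d, M - 1 - a = c + d := ⟨M - 1 - a - c, by omega⟩
  rw [hd, pow_add, mul_nsmul, hkill, nsmul_zero]

end Counting

end Summit.BirchSwinnertonDyer.BirchSwinnertonDyer.Theorems.GenusExact.FrobeniusCriterion

end
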